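import Literature.NumberTheory.LFunctions.WeilTwoPrimeOddMarginHBase
import Literature.NumberTheory.LFunctions.WeilTwoPrimeOddMarginHDataP22
import Literature.NumberTheory.LFunctions.WeilBlockRowsP
import HarnessLib

/-!
# Two-prime odd-margin certificate H: the materialized block agrees with `P_r`, rows 10–19

`WeilCert.checkPmRow` (row `k` of the claim `Pm_{kl} = P_r(2k+1, 2l+1)`) for certificate H, by `decide +kernel`. Pure proof file; nothing is asserted.
-/

noncomputable section

namespace Literature.NumberTheory.LFunctions

set_option maxHeartbeats 0 in
/-- Row 10 of the materialized block is row 10 of `P_r` (certificate H). [folklore] -/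
theorem checkPmRow1_10_weilCert23H : weilCert23HBase.checkPmRow weilCert23HNu weilCert23HPm 1 10 = true := by
  decide +kernel

set_option maxHeartbeats 0 in
/-- Row 11 of the materialized block is row 11 of `P_r` (certificate H). [folklore] -/
theorem checkPmRow1_11_weilCert23H : weilCert23HBase.checkPmRow weilCert23HNu weilCert23HPm 1 11 = true := by
  decide +kernel

set_option maxHeartbeats 0 in
/-- Row 12 of the materialized block is row 12 of `P_r` (certificate H). [folklore] -/
theorem checkPmRow1_12_weilCert23H : weilCert23HBase.checkPmRow weilCert23HNu weilCert23HPm 1 12 = true := by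
  decide +kernel

set_option maxHeartbeats 0 in
/-- Row 13 of the materialized block is row 13 of `P_r` (certificate H). [folklore] -/
theorem checkPmRow1_13_weilCert23H : weilCert23HBase.checkPmRow weilCert23HNu weilCert23HPm 1 13 = true := by
  decide +kernel

set_option maxHeartbeats 0 in
/-- Row 14 of the materialized block is row 14 of `P_r` (certificate H). [folklore] -/
theorem checkPmRow1_14_weilCert23H : weilCert23HBase.checkPmRow weilCert23HNu weilCert23HPm 1 14 = true := by
  decide +kernel

set_option maxHeartbeats 0 in
/-- Row 15 of the materialized block is row 15 of `P_r` (certificate H). [folklore] -/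
theorem checkPmRow1_15_weilCert23H : weilCert23HBase.checkPmRow weilCert23HNu weilCert23HPm 1 15 = true := by
  decide +kernel

set_option maxHeartbeats 0 in
/-- Row 16 of the materialized block is row 16 of `P_r` (certificate H). [folklore] -/
theorem checkPmRow1_16_weilCert23H : weilCert23HBase.checkPmRow weilCert23HNu weilCert23HPm 1 16 = true := by
  decide +kernel

set_option maxHeartbeats 0 in
/-- Row 17 of the materialized block is row 17 of `P_r` (certificate H). [folklore] -/
theorem checkPmRow1_17_weilCert23H : weilCert23HBase.checkPmRow weilCert23HNu weilCert23HPm 1 17 = true := by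
  decide +kernel

set_option maxHeartbeats 0 in
/-- Row 18 of the materialized block is row 18 of `P_r` (certificate H). [folklore] -/
theorem checkPmRow1_18_weilCert23H : weilCert23HBase.checkPmRow weilCert23HNu weilCert23HPm 1 18 = true := by
  decide +kernel

set_option maxHeartbeats 0 in
/-- Row 19 of the materialized block is row 19 of `P_r` (certificate H). [folklore] -/
theorem checkPmRow1_19_weilCert23H : weilCert23HBase.checkPmRow weilCert23HNu weilCert23HPm 1 19 = true := by
  decide +kernel


end Literature.NumberTheory.LFunctions
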